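import Summits.QuantumFields.BalabanUV.Beta.AveragingWardRooted

/-!
# `BalabanUV.Beta.AveragingWardRootedKernels` — node 8ρ, leaf 2 of 3: THE BACKWARD-DIVERGENCE LAWS (K-H)ρ, (K-V1)ρ of the
# ROOTED averaging-jet kernels `hessCountAt ρ`, `vhCountAt ρ` of node 7aρ and their real forms, from the rooted Ward
# identities of `AveragingWardRooted`, v1

HONEST FRAMING (page 1, mandatory).  This leaf belongs to the β sub-cell of the Bałaban audit, whose END STATEMENT is:
discharging the one-loop hypothesis `FlowStep.BetaPertH` makes Bałaban's ultraviolet stability theorem for 4-d lattice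
Yang–Mills ([Balaban1989LargeFieldII], Thm. 1 p. 355) UNCONDITIONAL inside this package — a real constructive-QFT result;
it is NOT the continuum limit and NOT the Clay problem.  EVERYTHING below is kernel-proved [folklore] algebra of finite
letter lists and finite sums on `ℤ^d`; NOTHING is cited as a fact; B7 (11) («Ū^u = (Ū)^u», the gauge covariance of the
averaging) is NOT asserted, at any order.  HONEST DEPENDENCY (cell records, verbatim): «continuum YM on T⁴ ⇐ BetaPertH ∧
nine spine estimates (0/9 proved); BetaPertH ⇐ (D1) ∧ (D4) ∧ CAP+tail; G-an2-4 gates asym, D1 and NE2/3/4.»  This leaf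
is a DATUM for row D1's gauge binder (the (W1)/(W2)-type input of `Beta.KernelWard.ward_hess` for the vh-piece of the
rooted one-step spine); it is NOT `BetaPertH`.

ABSOLUTE RULE (cell charter, verbatim): «No internally-minted statement may enter as a cited fact. Every hypothesis is
either kernel-proved in this package or a verbatim quotation of a PUBLISHED theorem with page reference. The manuscript(s)
under audit are NOT citable for their own disputed steps — they are the thing under adjudication; programme-internal
(2001/route/tribunal) claims are never citable.»  Accordingly NO declaration below is a `def … : Prop` carrying a
citation and no hypothesis of any theorem is a printed statement: every declaration is [folklore].

WHY THESE LEAVES (node 8ρ = `AveragingWardRooted` + `AveragingWardRootedKernels` + `AveragingWardRootedStencils`).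
β-lead RULING (R26) P6c / (R28-2) name the an1-owed datum «averaging jets: background-gauge covariance at SECOND order»;
node 8 (`Beta.AveragingWardJets`) / node 8b (`Beta.AveragingWardStencils`) delivered it for the BASE-CORNER root `L·y`
of node 5.  RULING (R32) re-rooted the road's literal family at a generic offset (`ρ = ctr`, odd `L`, the centred system
of [Balaban1987RG1] p.251): node 5ρ (`Beta.AveragingContoursRooted`), node 7aρ (`Beta.AveragingHessianKernelsRooted`),
and an2's ROOTED spine `SpineRootedS0N.S0NAt ρ cE cVH cΛ := cE • wilsonA + cVH • vhSAt ρ d Lc + cΛ • SLam …` (native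
placement) now consume `vhSAt ρ`, NOT `vhS`.  Node 8ρ is the rooted twin of node 8 + node 8b: every theorem re-proved
ρ-generically by node 8's own scripts with the root `L·y` replaced by `r(y) = L·y + ρ`, the `ρ = 0` instances identified
with node 8 / node 8b BY NAME; split in three leaves by the tree's size lint (letters here; the kernel laws (K-H)ρ, (K-V1)ρ
in `…Kernels`; the consumed law (K-V2)ρ and the stencil law (S-V)ρ in both placements in `…Stencils`).

WHAT IS TYPED HERE (`r = L·y + ρ`, `q¹,ρ = linCountAt ρ` / `linKerAt ρ`):
* (K-H)ρ `hessCountAt_div_left` / (K-H′)ρ `hessCountAt_div_right`: for every fine site `z`,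
  `Σ_κ (hessCountAt ρ (κ, z − e_κ) f′ − hessCountAt ρ (κ, z) f′) = ([f′₋ = z] + [f′₊ = z] − [r = z] − [r + L·e_μ = z]) · q¹,ρ(f′)`
  — the contact sits at the endpoints of `f′` and at BOTH endpoints of the coarse bond FROM THE ROOT;
* (K-V1)ρ `vhCountAt_div_left`: `… = 2L^d · ([f′₊ = z] − [r + L·e_μ = z]) · q¹,ρ(f′)` (fluctuation bond);
* the real-kernel forms `hessKerAt_div_left`, `vhKerAt_div_left` (`1 ≤ L`); `decide`d toys (`d = 1`, `L = 3`, `ρ = 1`).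
The background-bond law (K-V2)ρ `vhCountAt_div_right` / `vhKerAt_div_right` — the one the packed stencil consumes — is in
`AveragingWardRootedStencils` together with the stencil law (S-V)ρ.

WHAT IS NOT PROVED / NOT CLAIMED: as in `AveragingWardRooted` — nothing printed, B7 (11) NOT asserted, NOT (W1′)/(W2′),
NOT (R45), NOT `BetaPertH`.

Provenance: cell pub-balaban, β sub-cell, lineage an1, gen 23 (2026-08-20), node 8ρ of the an1 plan; over node 8 (an1 gen 12),
node 5ρ / 7aρ (an1 gen 13/14) and an5's `RootedKernelReflection` (two letter projections, BY NAME); no existing file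
touched.  Bib keys (locators only): Balaban1985Averaging, Balaban1987RG1, Balaban1989LargeFieldII.
-/

open Finset
open Literature.MathematicalPhysics.QuantumFieldTheory.Balaban1983to89
open Literature.MathematicalPhysics.QuantumFieldTheory.Balaban1983to89.Beta
open AffineAveraging AveragingContours TransportedContourVariables AveragingHessianKernels AveragingWardJets
  AveragingContoursRooted AveragingHessianKernelsRooted
open Summit.QuantumFields.BalabanUV.Beta.AveragingWardRooted

namespace Summit.QuantumFields.BalabanUV.Beta.AveragingWardRootedKernels

section Kernel

variable {d : ℕ}

/-- [folklore] **(K-H)ρ BACKWARD-DIVERGENCE LAW OF THE ROOTED W-HESSIAN KERNEL in its first bond**: for every fine site `z`,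
`Σ_κ (hessCountAt ρ (κ, z − e_κ) f′ − hessCountAt ρ (κ, z) f′) = ([f′₋ = z] + [f′₊ = z] − [r = z] − [r + L·e_μ = z]) · linCountAt ρ f′`:
the contact term sits at the endpoints of `f′` and at the two endpoints OF THE COARSE BOND FROM THE ROOT. -/
theorem hessCountAt_div_left (ρ : Fin d → ℤ) (L : ℕ) (μ : Fin d) (y : Fin d → ℤ) (z : Fin d → ℤ) (f' : Bond d) :
    ∑ κ : Fin d, (hessCountAt ρ L μ y (κ, z - unitVec κ) f' - hessCountAt ρ L μ y (κ, z) f')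
      = ((if f'.2 = z then 1 else 0) + (if f'.2 + unitVec f'.1 = z then 1 else 0)
          - (if (L : ℤ) • y + ρ = z then 1 else 0) - (if (L : ℤ) • y + ρ + (L : ℤ) • unitVec μ = z then 1 else 0))
        * linCountAt ρ L μ y f' := by
  simp only [hessCountAt_eq_skewHessAt, ← skewHessAt_sub_left, ← skewHessAt_sum_left, ← grad_siteδ,
    skewHessAt_grad_left, midF_mulZ_siteδ, linAvgAt_single, siteδ_apply, AddMonoidHom.mul_apply, smul_eq_mul]
  rw [show linAvgAt ρ (δ1 f') L μ y = linCountAt ρ L μ y f' from rfl]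
  ring

/-- [folklore] **(K-H′)ρ … in its second bond** (antisymmetry `hessCountAt_swap`). -/
theorem hessCountAt_div_right (ρ : Fin d → ℤ) (L : ℕ) (μ : Fin d) (y : Fin d → ℤ) (f : Bond d) (z : Fin d → ℤ) :
    ∑ κ : Fin d, (hessCountAt ρ L μ y f (κ, z - unitVec κ) - hessCountAt ρ L μ y f (κ, z))
      = -(((if f.2 = z then 1 else 0) + (if f.2 + unitVec f.1 = z then 1 else 0)
          - (if (L : ℤ) • y + ρ = z then 1 else 0) - (if (L : ℤ) • y + ρ + (L : ℤ) • unitVec μ = z then 1 else 0))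
        * linCountAt ρ L μ y f) := by
  rw [← hessCountAt_div_left, ← Finset.sum_neg_distrib]
  refine Finset.sum_congr rfl fun κ _ => ?_
  rw [hessCountAt_swap ρ L μ y f (κ, z - unitVec κ), hessCountAt_swap ρ L μ y f (κ, z)]
  ring

/-- [folklore] **(K-V1)ρ BACKWARD-DIVERGENCE LAW OF THE ROOTED PRODUCT-CHART KERNEL in its FLUCTUATION bond**:
`Σ_κ (vhCountAt ρ (κ, z − e_κ) f′ − vhCountAt ρ (κ, z) f′) = 2L^d · ([f′₊ = z] − [r + L·e_μ = z]) · linCountAt ρ f′`. -/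
theorem vhCountAt_div_left (ρ : Fin d → ℤ) (L : ℕ) (μ : Fin d) (y : Fin d → ℤ) (z : Fin d → ℤ) (f' : Bond d) :
    ∑ κ : Fin d, (vhCountAt ρ L μ y (κ, z - unitVec κ) f' - vhCountAt ρ L μ y (κ, z) f')
      = 2 * (L : ℤ) ^ d
        * (((if f'.2 + unitVec f'.1 = z then 1 else 0) - (if (L : ℤ) • y + ρ + (L : ℤ) • unitVec μ = z then 1 else 0))
          * linCountAt ρ L μ y f') := by
  simp only [vhCountAt_eq_skewVHAt, ← skewVHAt_sub_left, ← skewVHAt_sum_left, ← grad_siteδ, skewVHAt_grad_left,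
    endF_mulZ_siteδ, linAvgAt_single, siteδ_apply, AddMonoidHom.mul_apply, smul_eq_mul]
  rw [show linAvgAt ρ (δ1 f') L μ y = linCountAt ρ L μ y f' from rfl]
  ring

/-- [folklore] (K-H)ρ for the REAL rooted kernel `h^ρ = hessCountAt ρ/(2L^d)`: divergence `= (contact indicator) · q¹,ρ(f′)/2`. -/
theorem hessKerAt_div_left {L : ℕ} (hL : 1 ≤ L) (ρ : Fin d → ℤ) (μ : Fin d) (y : Fin d → ℤ) (z : Fin d → ℤ)
    (f' : Bond d) :
    ∑ κ : Fin d, (hessKerAt ρ L μ y (κ, z - unitVec κ) f' - hessKerAt ρ L μ y (κ, z) f')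
      = ((if f'.2 = z then 1 else 0) + (if f'.2 + unitVec f'.1 = z then 1 else 0)
          - (if (L : ℤ) • y + ρ = z then 1 else 0) - (if (L : ℤ) • y + ρ + (L : ℤ) • unitVec μ = z then 1 else 0))
        * linKerAt ρ L μ y f' / 2 := by
  have hL' : (L : ℝ) ≠ 0 := by exact_mod_cast (show L ≠ 0 by omega)
  simp only [hessKerAt, linKerAt, ← sub_div, ← Finset.sum_div, ← Int.cast_sub, ← Int.cast_sum, hessCountAt_div_left]
  push_cast
  field_simp

/-- [folklore] (K-V1)ρ for the REAL rooted kernel `m^ρ = vhCountAt ρ/(2L^{2d})`: divergence in the fluctuation bond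
`= ([f′₊ = z] − [r + L·e_μ = z]) · q¹,ρ(f′)`. -/
theorem vhKerAt_div_left {L : ℕ} (hL : 1 ≤ L) (ρ : Fin d → ℤ) (μ : Fin d) (y : Fin d → ℤ) (z : Fin d → ℤ)
    (f' : Bond d) :
    ∑ κ : Fin d, (vhKerAt ρ L μ y (κ, z - unitVec κ) f' - vhKerAt ρ L μ y (κ, z) f')
      = ((if f'.2 + unitVec f'.1 = z then 1 else 0) - (if (L : ℤ) • y + ρ + (L : ℤ) • unitVec μ = z then 1 else 0))
        * linKerAt ρ L μ y f' := by
  have hL' : (L : ℝ) ≠ 0 := by exact_mod_cast (show L ≠ 0 by omega)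
  simp only [vhKerAt, linKerAt, ← sub_div, ← Finset.sum_div, ← Int.cast_sub, ← Int.cast_sum, vhCountAt_div_left]
  push_cast
  field_simp
  ring

end Kernel

/-! ## DECIDED toy checks (`d = 1`, `L = 3`, `y = 0`, CENTRED ROOT `ρ = 1`: `r = 1`, `r + L = 4`; bonds `c_s = (0, s)`;
node 7aρ §10 tables: `linCountAt 1 = (0, 3, 3, 3, 0)` on `c₀…c₄`, `hessCountAt 1 (c_s, c_{s′}) = 3` for `1 ≤ s < s′ ≤ 3`,
`vhCountAt 1 (c₂, c₁) = vhCountAt 1 (c₃, c₁) = −18`) -/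

section Toy

/-- (K-V1)ρ at `z = r + L = 4`, `f′ = c₁`: `vhCountAt(c₃, c₁) − vhCountAt(c₄, c₁) = −18 = 2·3·([2 = 4] − [4 = 4])·3`. -/
example : ∑ κ : Fin 1, (vhCountAt (fun _ => 1) 3 0 (fun _ => 0) (κ, (fun _ => (4 : ℤ)) - unitVec κ) (0, fun _ => 1)
    - vhCountAt (fun _ => 1) 3 0 (fun _ => 0) (κ, fun _ => 4) (0, fun _ => 1)) = -18 := by decide

/-- (K-H)ρ at the root `z = 1`, `f′ = c₂`: `hessCountAt(c₀, c₂) − hessCountAt(c₁, c₂) = 0 − 3 = −3 = (0 + 0 − [1 = 1] − 0)·3`. -/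
example : ∑ κ : Fin 1, (hessCountAt (fun _ => 1) 3 0 (fun _ => 0) (κ, (fun _ => (1 : ℤ)) - unitVec κ) (0, fun _ => 2)
    - hessCountAt (fun _ => 1) 3 0 (fun _ => 0) (κ, fun _ => 1) (0, fun _ => 2)) = -3 := by decide

end Toy

end Summit.QuantumFields.BalabanUV.Beta.AveragingWardRootedKernels
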